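import Literature.Analysis.FluidPDE.Ferrari1993H3BoundRegularity
import HarnessLib

/-!
# `Ferrari1993_periodicCylinderContinuation` and its dependents on the two analytic estimates of
Ferrari's Theorem 2 and Kato–Lai's uniform-time existence

Topic `Literature/Analysis/FluidPDE`. Assembly file for the named fact
`Literature.Analysis.FluidPDE.Ferrari1993_periodicCylinderContinuation`
(`ChenHouContinuationProofs.lean`; the contrapositive of Ferrari 1993, Thm 2, p. 279, in the smooth
periodic class: a solution whose vorticity stays bounded up to `T` is continued past `T`). The
decomposition of that fact along Ferrari's printed proof (§1, pp. 279–283 of the held text) is now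
spread over four files:

* `Ferrari1993Continuation.lean` — the continuation argument pp. 282–283, proved:
  `Ferrari1993_periodicCylinderContinuation_of_parts : H³ bound → uniform existence → uniqueness →
  target`;
* `KatoLaiPeriodicCylinderProofs.lean` — uniqueness discharged
  (`KatoLai1984_periodicCylinderUniqueness_holds`), fed in by `KatoLaiUniformExistenceBridge.lean`
  (`Ferrari1993_periodicCylinderContinuation_of_H3Bound_of_uniformExistence`);
* `Ferrari1993H3Bound.lean` — the Gronwall step (15)–(17), proved, reducing the `H³` bound (7) to
  the `H^s` energy inequality (13)–(14) (`Ferrari1993_periodicCylinderHsEnergyInequality`) and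
  the logarithmic `W^{1,∞}` estimate (6)/(31) in the general-topology form of Shirota–Yanagisawa
  1993, (15)/(17) (`ShirotaYanagisawa1993_periodicCylinderLogEstimate`);
* `Ferrari1993H3BoundRegularity.lean` — the time-regularity input of that step discharged
  (`Ferrari1993_periodicCylinderH3Bound_of_energyInequality_of_logEstimate`).

This file records the resulting end-to-end statements: the continuation fact, the BKM criterion in
the periodic cylinder (`Ferrari1993_periodicCylinderEulerBKM`) and the Chen–Hou blow-up
(`chen_hou_blowup`) on the trust base {`Ferrari1993_periodicCylinderHsEnergyInequality`,
`ShirotaYanagisawa1993_periodicCylinderLogEstimate`, `KatoLai1984_periodicCylinderUniformExistence`}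
(plus `ChenHou2022_aprioriBlowupEstimates` for the last) — i.e. on Kato–Lai's local `H^s` theory
in the cylinder (energy inequality with the Neumann pressure estimate; existence with a time
uniform in the `H³` size) and the logarithmic div–curl estimate up to the boundary, the analytic
content of Ferrari's Thms 1–2 that Mathlib cannot yet support. Nothing here is a new named fact.
-/

noncomputable section

namespace Literature.Analysis.FluidPDE

/-- **Continuation past a time of bounded vorticity (`Ferrari1993_periodicCylinderContinuation`)
from the `H^s` energy inequality, the logarithmic estimate and the uniform-time existence**:
Ferrari 1993, proof of Thm 2, pp. 279–283, with the `H³` bound supplied by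
`Ferrari1993_periodicCylinderH3Bound_of_energyInequality_of_logEstimate` and the continuation by
`Ferrari1993_periodicCylinderContinuation_of_H3Bound_of_uniformExistence` (uniqueness discharged).
[cite: Ferrari1993, Thm 2 (p. 279) and its proof pp. 279–283] -/
theorem Ferrari1993_periodicCylinderContinuation_of_energyInequality_of_logEstimate
    (hA : Ferrari1993_periodicCylinderHsEnergyInequality)
    (hB : ShirotaYanagisawa1993_periodicCylinderLogEstimate)
    (hE : KatoLai1984_periodicCylinderUniformExistence) :
    Ferrari1993_periodicCylinderContinuation :=
  Ferrari1993_periodicCylinderContinuation_of_H3Bound_of_uniformExistence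
    (Ferrari1993_periodicCylinderH3Bound_of_energyInequality_of_logEstimate hA hB) hE

/-- **The BKM criterion in the periodic cylinder (`Ferrari1993_periodicCylinderEulerBKM`) from the
two analytic estimates and the uniform-time existence**
(`Ferrari1993_periodicCylinderEulerBKM_of_H3Bound_of_uniformExistence` with the `H³` bound from
`Ferrari1993_periodicCylinderH3Bound_of_energyInequality_of_logEstimate`). [cite: Ferrari1993, Thms 1–2 (p. 279)] -/
theorem Ferrari1993_periodicCylinderEulerBKM_of_energyInequality_of_logEstimate
    (hA : Ferrari1993_periodicCylinderHsEnergyInequality)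
    (hB : ShirotaYanagisawa1993_periodicCylinderLogEstimate)
    (hE : KatoLai1984_periodicCylinderUniformExistence) : Ferrari1993_periodicCylinderEulerBKM :=
  Ferrari1993_periodicCylinderEulerBKM_of_H3Bound_of_uniformExistence
    (Ferrari1993_periodicCylinderH3Bound_of_energyInequality_of_logEstimate hA hB) hE

/-- **The Chen–Hou blow-up (`chen_hou_blowup`) from the two analytic estimates, the uniform-time
existence and Chen–Hou's a-priori blow-up estimates**
(`chen_hou_blowup_of_H3Bound_of_uniformExistence` with the `H³` bound from
`Ferrari1993_periodicCylinderH3Bound_of_energyInequality_of_logEstimate`). Trust base of a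
dependent: `Ferrari1993_periodicCylinderHsEnergyInequality`,
`ShirotaYanagisawa1993_periodicCylinderLogEstimate`, `KatoLai1984_periodicCylinderUniformExistence`,
`ChenHou2022_aprioriBlowupEstimates`. [cite: arXiv221007191, §1 Theorem 2 (p. 3) and §6.1 Theorem 4 (p. 54)] -/
theorem chen_hou_blowup_of_energyInequality_of_logEstimate
    (hA : Ferrari1993_periodicCylinderHsEnergyInequality)
    (hB : ShirotaYanagisawa1993_periodicCylinderLogEstimate)
    (hE : KatoLai1984_periodicCylinderUniformExistence)
    (hCH : ChenHou2022_aprioriBlowupEstimates) : chen_hou_blowup :=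
  chen_hou_blowup_of_H3Bound_of_uniformExistence
    (Ferrari1993_periodicCylinderH3Bound_of_energyInequality_of_logEstimate hA hB) hE hCH

end Literature.Analysis.FluidPDE
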